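import Summits.AtomisticToContinuum.Crystallization.Theorems.OverbindingBudgetAffineFarLayerRows

/-!
# The height floor and the row box on the ρ₁ = 1/10 annulus (far side of slot Z, leaf Z2)

Companion to `OverbindingBudgetAffineFarLayerRows`: on the ball `‖y‖ ≤ 11/100` of chart coordinates (the `ρ₁ = 1/10` annulus
around a centre `x₀` with `‖x₀‖ ≤ 1/100`) we PROVE the two non-jet conjuncts of the pointwise hypotheses `hmaj` / `hmin` of
★★★ `…OverbindingBudgetAffineRadialJetFar.farCoreExcess_of_threeZoneFarMainTables` for the certified rows of that file:
the ROW BOX (`|y₀|, |y₂| ≤ 11/100`) and the HEIGHT FLOOR `δlo²·detPar y ≤ detFull y` with `δlo = 37/50` (rows A) and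
`18/25` (rows B).  The floor is an elementary cubic inequality: the exact split
`detFull − κ·detPar = (2/3 − κ + y₄)·detPar − (y₃² − (1 + 2y₀)y₁y₃ + (1 + y₂)y₁²)`, the bracket `≤ (43/25)(y₁² + y₃²)`,
`detPar ≥ 5179/10000`, and the budget `y₁² + y₃² + y₄² ≤ (11/100)²` traded against the factor `2/3 − κ + y₄`
(margin `≥ 4·10⁻³`; the floor holds on the BALL, not on the coordinate box, whose corners have norm `≈ 1/4`).

Main results: ★★ `floor_of_norm_le : ‖y‖ ≤ 11/100 → (1369/2500)·detPar y ≤ detFull y`,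
★★ `farTenth_pointwise : ‖x₀‖ ≤ 1/100 → ‖y − x₀‖ ≤ 1/10 → InRowBox annRowTenthMu2 y ∧ InRowBox annRowTenthMu5 y ∧ (37/50)²·detPar y ≤ detFull y`
(and `farTenthB_pointwise` for rows B) — so at `ρ₁ = 1/10` the far-side hypotheses of ★★★ reduce to the two JET inequalities
`Σ_{|k|≤3} rests + farMainSix y + rem₂ ≤ (J₃ w).eval y` and `(J₆ w).eval y ≤ farMainTwelve N y − rem₅` alone.

Complete proofs, no new axioms, Mathlib only (`PiLp.norm_apply_le`, `EuclideanSpace.real_norm_sq_eq`, `nlinarith`).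
-/

open Summit.AtomisticToContinuum.Crystallization.Theorems.OverbindingBudgetAffineFarSmoothSplit
open Summit.AtomisticToContinuum.Crystallization.Theorems.OverbindingBudgetAffineFarLayerMain
open Summit.AtomisticToContinuum.Crystallization.Theorems.OverbindingBudgetAffineFarLayerRows

namespace Summit.AtomisticToContinuum.Crystallization.Theorems.OverbindingBudgetAffineFarLayerFloor

/-- ★ Coordinates are bounded by the Euclidean norm. [Mathlib: PiLp.norm_apply_le] -/
theorem abs_apply_le_norm (y : EuclideanSpace ℝ (Fin 5)) (i : Fin 5) : |y i| ≤ ‖y‖ := by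
  have h := PiLp.norm_apply_le y i
  rwa [Real.norm_eq_abs] at h

/-- ★ `Σ yᵢ² = ‖y‖²`. [Mathlib: EuclideanSpace.real_norm_sq_eq] -/
theorem sum_sq_eq_norm_sq (y : EuclideanSpace ℝ (Fin 5)) :
    y 0 ^ 2 + y 1 ^ 2 + y 2 ^ 2 + y 3 ^ 2 + y 4 ^ 2 = ‖y‖ ^ 2 := by
  rw [EuclideanSpace.real_norm_sq_eq y, Fin.sum_univ_five]

/-- ★ `detPar ≥ 5179/10000` on the ball of radius `11/100`. [this file] -/
theorem detPar_ge_of_norm_le {y : EuclideanSpace ℝ (Fin 5)} (hy : ‖y‖ ≤ 11 / 100) : 5179 / 10000 ≤ detPar y := by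
  have h0 := abs_le.1 ((abs_apply_le_norm y 0).trans hy)
  have h2 := abs_le.1 ((abs_apply_le_norm y 2).trans hy)
  have hsq : y 0 ^ 2 ≤ 121 / 10000 := by nlinarith [h0.1, h0.2]
  unfold detPar; nlinarith [h0.1, h0.2, h2.1, h2.2, hsq]

/-- ★★ HEIGHT FLOOR on the ball of radius `11/100`: `(37/50)²·detPar y ≤ detFull y`. [this file; elementary] -/
theorem floor_of_norm_le {y : EuclideanSpace ℝ (Fin 5)} (hy : ‖y‖ ≤ 11 / 100) :
    1369 / 2500 * detPar y ≤ detFull y := by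
  have h0 := abs_le.1 ((abs_apply_le_norm y 0).trans hy)
  have h2 := abs_le.1 ((abs_apply_le_norm y 2).trans hy)
  have h4 := abs_le.1 ((abs_apply_le_norm y 4).trans hy)
  have hn : ‖y‖ ^ 2 ≤ (11 / 100) ^ 2 := pow_le_pow_left₀ (norm_nonneg y) hy 2
  have hs := sum_sq_eq_norm_sq y
  have hbde : y 1 ^ 2 + y 3 ^ 2 + y 4 ^ 2 ≤ 121 / 10000 := by nlinarith [sq_nonneg (y 0), sq_nonneg (y 2)]
  have hq : 5179 / 10000 ≤ detPar y := detPar_ge_of_norm_le hy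
  set a := y 0; set b := y 1; set c := y 2; set d := y 3; set e := y 4
  have hK : (0 : ℝ) ≤ 893 / 7500 + e := by linarith [h4.1]
  have hsplit : detFull y - 1369 / 2500 * detPar y
      = (893 / 7500 + e) * detPar y - (d ^ 2 - (1 + 2 * a) * b * d + (1 + c) * b ^ 2) := by
    unfold detFull detPar; ring
  have hB1 : -((1 + 2 * a) * b * d) ≤ (1 + 2 * a) * ((b ^ 2 + d ^ 2) / 2) := by
    have h1 : 0 ≤ 1 + 2 * a := by linarith [h0.1]
    nlinarith [mul_nonneg h1 (sq_nonneg (b + d))]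
  have hB2 : (1 + 2 * a) * ((b ^ 2 + d ^ 2) / 2) ≤ 61 / 50 * ((b ^ 2 + d ^ 2) / 2) := by
    have h1 : 0 ≤ 61 / 50 - (1 + 2 * a) := by linarith [h0.2]
    nlinarith [mul_nonneg h1 (add_nonneg (sq_nonneg b) (sq_nonneg d))]
  have hB3 : (1 + c) * b ^ 2 ≤ 111 / 100 * b ^ 2 := by
    have h1 : 0 ≤ 111 / 100 - (1 + c) := by linarith [h2.2]
    nlinarith [mul_nonneg h1 (sq_nonneg b)]
  have hB : d ^ 2 - (1 + 2 * a) * b * d + (1 + c) * b ^ 2 ≤ 43 / 25 * (b ^ 2 + d ^ 2) := by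
    nlinarith [sq_nonneg b, sq_nonneg d]
  have hmain : (893 / 7500 + e) * (5179 / 10000) ≤ (893 / 7500 + e) * detPar y :=
    mul_le_mul_of_nonneg_left hq hK
  have he : 0 ≤ (e + 11 / 100) * (43 / 25 * (e - 11 / 100) + 5179 / 10000) :=
    mul_nonneg (by linarith [h4.1]) (by linarith [h4.1])
  nlinarith [hbde, hB, hmain, he, hsplit]

/-- ★ From the annulus to the ball: `‖x₀‖ ≤ 1/100`, `‖y − x₀‖ ≤ 1/10` ⇒ `‖y‖ ≤ 11/100`. -/
theorem norm_le_of_annulus {x₀ y : EuclideanSpace ℝ (Fin 5)} (hx₀ : ‖x₀‖ ≤ 1 / 100) (h : ‖y - x₀‖ ≤ 1 / 10) :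
    ‖y‖ ≤ 11 / 100 := by
  have := norm_le_norm_add_norm_sub' y x₀
  linarith [norm_sub_rev y x₀]

/-- ★★ THE ρ₁ = 1/10 FAR-SIDE POINTWISE PACKAGE (rows A, `δlo = 37/50`): for `‖x₀‖ ≤ 1/100` and `‖y − x₀‖ ≤ 1/10` the
first two conjuncts of the `hmaj`/`hmin` bodies of ★★★ `…RadialJetFar.farCoreExcess_of_threeZoneFarMainTables` hold with
`κ = Unit`, `R₂ w () = annRowTenthMu2`, `R₅ w () = annRowTenthMu5`, `δ w () = 37/50` — leaving ONLY the jet inequalities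
`Σ rests + farMainSix y + rem₂ ≤ (J₃ w).eval y` and `(J₆ w).eval y ≤ farMainTwelve N y − rem₅` to certify. [this file] -/
theorem farTenth_pointwise {x₀ y : EuclideanSpace ℝ (Fin 5)} (hx₀ : ‖x₀‖ ≤ 1 / 100) (h : ‖y - x₀‖ ≤ 1 / 10) :
    InRowBox annRowTenthMu2 y ∧ InRowBox annRowTenthMu5 y ∧ ((37 / 50 : ℚ) : ℝ) ^ 2 * detPar y ≤ detFull y := by
  have hy := norm_le_of_annulus hx₀ h
  have hb := inRowBox_annRowTenth ((abs_apply_le_norm y 0).trans hy) ((abs_apply_le_norm y 2).trans hy)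
  refine ⟨hb.1, hb.2, ?_⟩
  have hf := floor_of_norm_le hy
  push_cast
  linarith

/-- ★★ The same package for the variant-B rows (`δlo = 18/25`). [this file] -/
theorem farTenthB_pointwise {x₀ y : EuclideanSpace ℝ (Fin 5)} (hx₀ : ‖x₀‖ ≤ 1 / 100) (h : ‖y - x₀‖ ≤ 1 / 10) :
    InRowBox annRowTenthBMu2 y ∧ InRowBox annRowTenthBMu5 y ∧ ((18 / 25 : ℚ) : ℝ) ^ 2 * detPar y ≤ detFull y := by
  have hy := norm_le_of_annulus hx₀ h
  have hb := inRowBox_annRowTenthB ((abs_apply_le_norm y 0).trans hy) ((abs_apply_le_norm y 2).trans hy)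
  refine ⟨hb.1, hb.2, ?_⟩
  have hf := floor_of_norm_le hy
  have hq : 0 ≤ detPar y := le_trans (by norm_num) (detPar_ge_of_norm_le hy)
  push_cast
  nlinarith


end Summit.AtomisticToContinuum.Crystallization.Theorems.OverbindingBudgetAffineFarLayerFloor
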